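import Literature.AlgebraicGeometry.Motives.JacobianThetaKThetaTrivialOfMultOne
import Literature.AlgebraicGeometry.Motives.AbelianVarietyWeilPairingRadical
import Literature.AlgebraicGeometry.Motives.AbelianVarietyKummerBound
import HarnessLib

/-!
# A translation preserving the support of a multiplicity-one effective divisor lies in `K(D)`

Layer `Literature/AlgebraicGeometry/Motives` (namespace `….Motives.AbelianVariety`).  KERNEL ONLY (theorems; no definition, no named fact, no
instance, no `sorry`).

Mumford, *Abelian Varieties*, §6, Application 1 (pp. 60–61), the step «`t_x(Supp D) = Supp D ⇒ t_x^* D = D`» for a reduced (multiplicity-one)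
effective divisor `D`: on an abelian variety over a field, let `D` be an effective Cartier divisor with IRREDUCIBLE support `S = A ∖ A_1` and
MULTIPLICITY ONE in the weak ∕ effective form `hone : D ≈ m • E, E ≥ 0, m ≥ 1 ⇒ m = 1`.  If a translation `t_x` maps `S` onto itself then
`t_x^* D` is effective with the same irreducible support and again of multiplicity one (★ `CartierDivisor.forall_eq_one_pullback_of_comp_eq_id`
along the automorphism `t_x`, inverse `t_{x⁻¹}`), so `t_x^* D ≈ D` (★ `AbelianVariety.sameDivisor_of_support_eq_of_forall_eq_one`: both are the
prime divisor `[S]` on the regular `A`) and a fortiori `t_x^* D ∼ D`, i.e. `x ∈ K(D)` (★ `mem_KTheta_iff'`).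

* `AbelianVariety.sameDivisor_pullback_translation_of_image_support_eq` — `t_x^* D ≈ D`;
* **`AbelianVariety.mem_KTheta_of_image_translation_support_eq`** — `x ∈ K(D)` (letter (T) ∕ `stub_T` of the cell's G5 skeleton v2, A-p06 (g16)
  lead; second hand).

Use (cell `hodgecm-mathlib`, D-0151; crux HLiu418 = stmt-HodgeConjecture-24832, VI-7 side road (V7-c)).  COUNT-NEUTRAL.  HC_CM is proved only modulo the
7 printed citations until rung 0 closes; this file moves no book by itself.

## References
* [MumfordAV1970] D. Mumford, *Abelian Varieties* (1970), §6 Application 1 and its proof (pp. 60–61), Definition (p. 60) (`K(L)`).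
* [Hartshorne1977] R. Hartshorne, *Algebraic Geometry* (1977), II.6 Prop. 6.11 and Remark 6.11.2 (pp. 141–142).
* [GortzWedhorn2023] U. Görtz, T. Wedhorn, *Algebraic Geometry II* (2023), Def./Rem. 27.1 (pp. 604–605) (translations).
-/

set_option autoImplicit false

noncomputable section

universe u

open CategoryTheory AlgebraicGeometry TopologicalSpace

namespace Literature.AlgebraicGeometry.Motives

namespace AbelianVariety

variable {k : Type u} [Field k] (A : AbelianVariety k)

/-- The underlying map of a translation is injective (translations are isomorphisms, ★ `translationIso`). [cite: GortzWedhorn2023, Def./Rem. 27.1 (pp. 604–605)] -/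
theorem translation_base_injective (x : A.Points k) : Function.Injective (A.translation x).left.base :=
  (A.translation x).left.homeomorph.injective

variable {A}

/-- **`t_x(Supp D) = Supp D ⇒ t_x^* D ≈ D`** for an effective Cartier divisor `D` with irreducible support and multiplicity one (weak form):
the pull-back along the automorphism `t_x` is effective with support `t_x⁻¹(Supp D) = Supp D` and of multiplicity one (★
`forall_eq_one_pullback_of_comp_eq_id`), so both are the prime divisor of the common support (★ `sameDivisor_of_support_eq_of_forall_eq_one`).
[cite: MumfordAV1970, §6 Application 1 and its proof (pp. 60–61)] [cite: Hartshorne1977, II.6 Prop. 6.11 and Remark 6.11.2 (pp. 141–142)] -/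
theorem sameDivisor_pullback_translation_of_image_support_eq {D : CartierDivisor A.X.left} (hD : D.IsEffective)
    (hirr : IsIrreducible (D.nonvanishing 1)ᶜ)
    (hone : ∀ (E : CartierDivisor A.X.left) (m : ℕ), E.IsEffective → 0 < m → D.SameDivisor (m • E) → m = 1)
    {x : A.Points k} (hx : (A.translation x).left.base '' (D.nonvanishing 1)ᶜ = (D.nonvanishing 1)ᶜ) :
    (D.pullback (A.translation x).left).SameDivisor D := by
  -- the support of the pull-back is `t_x⁻¹(Supp D) = Supp D`
  have hsupp : ((D.pullback (A.translation x).left).nonvanishing 1)ᶜ = (D.nonvanishing 1)ᶜ := by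
    rw [hD.compl_nonvanishing_one_pullback]
    conv_lhs => rw [← hx]
    exact Set.preimage_image_eq _ (A.translation_base_injective x)
  -- multiplicity one passes to the pull-back along the automorphism `t_x` (inverse `t_{x⁻¹}`)
  have hid : (A.translation x⁻¹).left ≫ (A.translation x).left = 𝟙 A.X.left := by
    rw [← Over.comp_left, translation_inv_comp_translation]
    rfl
  have hone' := CartierDivisor.forall_eq_one_pullback_of_comp_eq_id D (A.translation x).left (A.translation x⁻¹).left hid hone
  exact A.sameDivisor_of_support_eq_of_forall_eq_one (hD.pullback _) hD hone' hone hsupp (hsupp.symm ▸ hirr)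

/-- **`t_x(Supp D) = Supp D ⇒ x ∈ K(D)`** (Mumford §6 Application 1, the multiplicity-one case): for an effective Cartier divisor `D` on an abelian
variety with irreducible support and multiplicity one (weak ∕ effective form), a translation mapping the support onto itself satisfies `t_x^* D ∼ D`.
Letter (T) of the cell's G5 skeleton (row VI-7). [cite: MumfordAV1970, §6 Application 1 and its proof (pp. 60–61)] -/
theorem mem_KTheta_of_image_translation_support_eq (A : AbelianVariety k) {D : CartierDivisor A.X.left} (hD : D.IsEffective)
    (hirr : IsIrreducible (D.nonvanishing 1)ᶜ)
    (hone : ∀ (E : CartierDivisor A.X.left) (m : ℕ), E.IsEffective → 0 < m → D.SameDivisor (m • E) → m = 1)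
    {x : A.Points k} (hx : (A.translation x).left.base '' (D.nonvanishing 1)ᶜ = (D.nonvanishing 1)ᶜ) : x ∈ A.KTheta D :=
  (A.mem_KTheta_iff' D x).mpr (sameDivisor_pullback_translation_of_image_support_eq hD hirr hone hx).linEquiv

end AbelianVariety

end Literature.AlgebraicGeometry.Motives

end
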